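import Summits.QuantumFields.YangMills.Theorems.BalabanLadderNTClassicalShadowLRO
import Summits.QuantumFields.YangMills.Theorems.BalabanLadderNTCeilingMinDepthReduction
import HarnessLib

/-!
# Crux `NT` (stmt-QuantumFields-19353), stub `stub_refpkgT : RefPkgT`: THE CLASSICAL SHADOW, XIII — the δ-ROBUST orbit test
# (approximate orbit sums on the ground states ⇒ the zero-temperature kernel covariance is within an explicit error of the orbit covariance)

Helper file (`--supports stmt-QuantumFields-19353`) of the fleet lead prover of crux `NT` (unit `ym-spine-19353-p1`, GEN 16); sequel of
`…ClassicalShadowOrbit` (p601276), `…BoundaryLayer` (p609347), `…LRO` (p609695).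

WHY.  The orbit test (`tendsto_kerCov_of_orbit`, prices `orbitCov_le_of_e2osc[_depthOne]`, kill-path `ClassicalOrbitCovFloorUnbounded ⇒
¬E2-osc`) rests on an EXACT variational input: the orbit sums `Σᵢ dens_x(γᵢ U)`, `Σᵢ dens_x(γᵢ U) dens_y(γᵢ U)` are CONSTANT on the ground states of
the frustrated box (e.g. because the ground-state set is exactly one `Γ`-orbit modulo gauge, `…OrbitClosure`).  That input can be delivered by
neither of the two instruments the classical programme has: numerics only ever see the minimisers FOUND, to a tolerance, and energy estimates
(trial configuration + constrained lower bound) locate ground states only up to a distance.  This file removes the exactness: if the orbit sums are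
within `Δ` of constants on the ground states, then the zero-temperature kernel data are eventually within `Δ/k + ε` of the orbit data, with an explicit
error budget in the covariance — so a δ-approximate one-orbit structure still PRICES clause 2, and an approximate family with non-decaying orbit
covariance still KILLS it.

* §1 `eventually_abs_kerE_sub_le_of_near` — range form of the Laplace step (Hwang): `|F − t| ≤ Δ` on `cubeMinimisers` ⇒ eventually
  `|kerE^η_β F − t| ≤ Δ + ε`;
* §2 **`eventually_abs_kerE_sub_orbitMean_le`** — kernel `γ`-symmetry + `|Σᵢ F∘γᵢ − M| ≤ Δ` on the ground states ⇒ eventually `|kerE^η_β F − M/k| ≤ Δ/k + ε`;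
* §3 **`eventually_abs_kerCov_sub_orbitCov_le`** — with tolerances `Δ₁, Δ₂, Δ₁₂` on the three orbit sums: eventually
  `|kerCov^η_β(dens_x, dens_y) − (M₁₂/k − (M₁/k)(M₂/k))| ≤ Δ₁₂/k + 6N·Δ₁/k + |M₁/k|·Δ₂/k + ε`;
* §4 the prices at the registered typing `1 ≤ depth`: **`orbitCov_le_of_e2osc_soft`** — clause 2 ⇒
  `|M₁₂/k − (M₁/k)(M₂/k)| − (Δ₁₂/k + 6N·Δ₁/k + |M₁/k|·Δ₂/k) ≤ C₂ / min(d_x,d_y)⁴ / (1 + ‖y − x‖)⁴`; `orbitMean_deficit_le_of_e1osc_soft` — clause 1 ⇒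
  `6N − M₁/k − Δ₁/k ≤ C₁/d_x⁴`;
* §5 the kill-path feed: **`zeroTempCovFloorUnbounded_of_softOrbit`** — a family of boxes with kernel-symmetric finite families, APPROXIMATE orbit sums
  and robust orbit covariance `|Cov_Γ| − error ≥ c₀ > 0` at unbounded separation ⇒ `ZeroTempCovFloorUnbounded G r` (hence `¬` clause 2 for every unit,
  `not_e2osc_of_zeroTempCovFloorUnbounded`).

At `Δ = 0` everything reduces to GEN 14/15's statements.  The companion file `…OrbitSoftClosure` supplies the `Δ`'s from «every ground state is
δ-close, in the density observables, to the `Γ`-orbit of ONE configuration» (`Δ₁ = Δ₂ = kδ`, `Δ₁₂ = 12N·kδ`).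

HONEST FRAMING.  Consequences of the registered clauses at fixed lattice geometry as `β → ∞`; the approximate one-orbit structure and the kernel
symmetries are HYPOTHESES (the latter tree-supplied for permutations / box reflections / gauge-fixed maps); nothing here asserts that such boxes exist;
no floor, not AF, not NT, not the seam, not the gap; not Clay.
-/

set_option autoImplicit false

noncomputable section

open MeasureTheory Filter Topology
open Literature.MathematicalPhysics.QuantumFieldTheory Literature.MathematicalPhysics.QuantumLattice
open Literature.Probability.LatticeModels
open Summit.QuantumFields.YangMills.Cruxes.OSLegsFromFemtoAndGap.DlrCollarTransfer
open Summit.QuantumFields.YangMills.Cruxes.UVSeamRec.BoundaryLawPenetration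

namespace Summit.QuantumFields.YangMills.Cruxes.NT.ClassicalShadow

variable {G : Type} [Group G] [TopologicalSpace G] [IsTopologicalGroup G] [CompactSpace G]
  [MeasurableSpace G] [BorelSpace G] (r : LatticeRep G)

/-! ## §1 The Laplace step in range form -/

section Range

variable (c : Fin 4 → ℤ) (b : ℕ) (η : LGConfig 4 G)

/-- **Range form of the zero-temperature step.**  If a continuous observable is within `Δ` of `t` on every ground state of the cube `(c, b)` with
exterior `η`, then for every `ε > 0`, eventually in `β`, `|kerE^η_β F − t| ≤ Δ + ε`. [cite: Hwang1980, Thm 2.1] -/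
theorem eventually_abs_kerE_sub_le_of_near {F : LGConfig 4 G → ℝ} (hF : Continuous F) {t Δ : ℝ}
    (h : ∀ ζ ∈ cubeMinimisers G r c b η, |F (glueWith (cubeEdges c b) ζ η) - t| ≤ Δ) {ε : ℝ} (hε : 0 < ε) :
    ∀ᶠ β : ℝ in atTop, |kerE G r β c b η F - t| ≤ Δ + ε := by
  haveI : SecondCountableTopology G := (Continuous.isClosedEmbedding r.continuous r.injective).isEmbedding.secondCountableTopology
  have h1 := kerE_eventually_ge (G := G) (r := r) c b η hF (t := t - Δ)
    (fun ζ hζ => by have h' := h ζ hζ; rw [abs_le] at h'; linarith [h'.1]) hε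
  have h2 := kerE_eventually_le (G := G) (r := r) c b η hF (t := t + Δ)
    (fun ζ hζ => by have h' := h ζ hζ; rw [abs_le] at h'; linarith [h'.2]) hε
  filter_upwards [h1, h2] with β hge hle
  rw [abs_le]
  constructor <;> linarith

end Range

/-! ## §2 The soft orbit mean -/

section Orbit

variable (c : Fin 4 → ℤ) (b : ℕ) (η : LGConfig 4 G) {ι : Type} [Fintype ι] [Nonempty ι]

/-- **δ-robust orbit mean.**  Let `γ i` (`i : ι`, finite, non-empty) be maps of the configuration space with `F ∘ γ i` continuous, leaving the
cube kernel of `η` invariant on `F`, and suppose the orbit sum `Σᵢ F ∘ γ i` is within `Δ` of `M` on the ground states.  Then for every `ε > 0`,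
eventually in `β`, `|kerE^η_β F − M/k| ≤ Δ/k + ε` (`k = |ι|`). [folklore] -/
theorem eventually_abs_kerE_sub_orbitMean_le (γ : ι → LGConfig 4 G → LGConfig 4 G) {F : LGConfig 4 G → ℝ}
    (hFγ : ∀ i, Continuous (F ∘ γ i)) {M Δ : ℝ}
    (hM : ∀ ζ ∈ cubeMinimisers G r c b η, |∑ i, F (γ i (glueWith (cubeEdges c b) ζ η)) - M| ≤ Δ)
    (hsymm : ∀ (β : ℝ) (i : ι), kerE G r β c b η (F ∘ γ i) = kerE G r β c b η F) {ε : ℝ} (hε : 0 < ε) :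
    ∀ᶠ β : ℝ in atTop, |kerE G r β c b η F - M / Fintype.card ι| ≤ Δ / Fintype.card ι + ε := by
  have hk : (0 : ℝ) < Fintype.card ι := Nat.cast_pos.2 Fintype.card_pos
  have e : ∀ β : ℝ, kerE G r β c b η F = kerE G r β c b η (fun U => ∑ i, (F ∘ γ i) U) / Fintype.card ι := fun β => by
    rw [kerE_fintype_sum r c b η β (fun i => F ∘ γ i) hFγ]
    simp only [hsymm β, Finset.sum_const, Finset.card_univ, nsmul_eq_mul]
    field_simp
  have h := eventually_abs_kerE_sub_le_of_near r c b η (F := fun U => ∑ i, (F ∘ γ i) U)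
    (continuous_finsetSum Finset.univ fun i _ => hFγ i) (t := M) (Δ := Δ)
    (fun ζ hζ => by simpa only [Function.comp_apply] using hM ζ hζ) (mul_pos hk hε)
  filter_upwards [h] with β hβ
  rw [e β, ← sub_div, abs_div, abs_of_pos hk, div_le_iff₀ hk]
  calc |kerE G r β c b η (fun U => ∑ i, (F ∘ γ i) U) - M| ≤ Δ + Fintype.card ι * ε := hβ
    _ = (Δ / Fintype.card ι + ε) * Fintype.card ι := by field_simp

/-! ## §3 The soft orbit covariance -/

/-- **δ-robust orbit test, two-point.**  With kernel symmetry under the `γ i` for `dens_x`, `dens_y`, `dens_x·dens_y` and the orbit sums of these three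
observables within `Δ₁, Δ₂, Δ₁₂` of `M₁, M₂, M₁₂` on the ground states, for every `ε > 0`, eventually in `β`:
`|kerCov^η_β(dens_x, dens_y) − (M₁₂/k − (M₁/k)(M₂/k))| ≤ Δ₁₂/k + 6N·(Δ₁/k) + |M₁/k|·(Δ₂/k) + ε`. [folklore] -/
theorem eventually_abs_kerCov_sub_orbitCov_le (γ : ι → LGConfig 4 G → LGConfig 4 G) (hγ : ∀ i, Continuous (γ i))
    {x y : Fin 4 → ℤ} {M₁ M₂ M₁₂ Δ₁ Δ₂ Δ₁₂ : ℝ}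
    (h₁ : ∀ ζ ∈ cubeMinimisers G r c b η, |∑ i, dens G r x (γ i (glueWith (cubeEdges c b) ζ η)) - M₁| ≤ Δ₁)
    (h₂ : ∀ ζ ∈ cubeMinimisers G r c b η, |∑ i, dens G r y (γ i (glueWith (cubeEdges c b) ζ η)) - M₂| ≤ Δ₂)
    (h₁₂ : ∀ ζ ∈ cubeMinimisers G r c b η,
      |∑ i, dens G r x (γ i (glueWith (cubeEdges c b) ζ η)) * dens G r y (γ i (glueWith (cubeEdges c b) ζ η)) - M₁₂| ≤ Δ₁₂)
    (s₁ : ∀ (β : ℝ) (i : ι), kerE G r β c b η (dens G r x ∘ γ i) = kerE G r β c b η (dens G r x))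
    (s₂ : ∀ (β : ℝ) (i : ι), kerE G r β c b η (dens G r y ∘ γ i) = kerE G r β c b η (dens G r y))
    (s₁₂ : ∀ (β : ℝ) (i : ι), kerE G r β c b η ((fun U => dens G r x U * dens G r y U) ∘ γ i) =
      kerE G r β c b η (fun U => dens G r x U * dens G r y U)) {ε : ℝ} (hε : 0 < ε) :
    ∀ᶠ β : ℝ in atTop, |kerCov G r β c b η (dens G r x) (dens G r y) -
        (M₁₂ / Fintype.card ι - M₁ / Fintype.card ι * (M₂ / Fintype.card ι))| ≤
      Δ₁₂ / Fintype.card ι + 6 * r.N * (Δ₁ / Fintype.card ι) + |M₁ / Fintype.card ι| * (Δ₂ / Fintype.card ι) + ε := by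
  set k : ℝ := (Fintype.card ι : ℝ) with hk
  have hD : 0 < 1 + 6 * (r.N : ℝ) + |M₁ / k| := by positivity
  set ε' : ℝ := ε / (1 + 6 * (r.N : ℝ) + |M₁ / k|) with hε'def
  have hε' : 0 < ε' := div_pos hε hD
  have hε'D : ε' * (1 + 6 * (r.N : ℝ) + |M₁ / k|) = ε := div_mul_cancel₀ ε hD.ne'
  have hX := eventually_abs_kerE_sub_orbitMean_le r c b η γ (fun i => (continuous_dens r x).comp (hγ i)) h₁ s₁ hε'
  have hY := eventually_abs_kerE_sub_orbitMean_le r c b η γ (fun i => (continuous_dens r y).comp (hγ i)) h₂ s₂ hε'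
  have hXY := eventually_abs_kerE_sub_orbitMean_le r c b η γ (F := fun U => dens G r x U * dens G r y U)
    (fun i => ((continuous_dens r x).mul (continuous_dens r y)).comp (hγ i)) h₁₂ s₁₂ hε'
  filter_upwards [hX, hY, hXY] with β hXβ hYβ hXYβ
  set X := kerE G r β c b η (dens G r x)
  set Y := kerE G r β c b η (dens G r y)
  set Z := kerE G r β c b η (fun U => dens G r x U * dens G r y U)
  have hYb : |Y| ≤ 6 * r.N := BoundaryLaw.abs_kerE_le G r β c b η (CornerPrice.abs_dens_le G r y)
  have eq : kerCov G r β c b η (dens G r x) (dens G r y) - (M₁₂ / k - M₁ / k * (M₂ / k)) =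
      (Z - M₁₂ / k) - (X - M₁ / k) * Y - M₁ / k * (Y - M₂ / k) := by
    unfold kerCov; ring
  have hB : |(X - M₁ / k) * Y| = |X - M₁ / k| * |Y| := abs_mul _ _
  have hC : |M₁ / k * (Y - M₂ / k)| = |M₁ / k| * |Y - M₂ / k| := abs_mul _ _
  calc |kerCov G r β c b η (dens G r x) (dens G r y) - (M₁₂ / k - M₁ / k * (M₂ / k))|
      = |(Z - M₁₂ / k) - (X - M₁ / k) * Y - M₁ / k * (Y - M₂ / k)| := by rw [eq]
    _ ≤ |(Z - M₁₂ / k) - (X - M₁ / k) * Y| + |M₁ / k * (Y - M₂ / k)| := abs_sub _ _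
    _ ≤ |Z - M₁₂ / k| + |(X - M₁ / k) * Y| + |M₁ / k * (Y - M₂ / k)| := by
        gcongr
        exact abs_sub _ _
    _ = |Z - M₁₂ / k| + |X - M₁ / k| * |Y| + |M₁ / k| * |Y - M₂ / k| := by rw [hB, hC]
    _ ≤ (Δ₁₂ / k + ε') + (Δ₁ / k + ε') * (6 * r.N) + |M₁ / k| * (Δ₂ / k + ε') := by
        have h2 : |X - M₁ / k| * |Y| ≤ (Δ₁ / k + ε') * (6 * r.N) :=
          mul_le_mul hXβ hYb (abs_nonneg _) ((abs_nonneg _).trans hXβ)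
        have h3 : |M₁ / k| * |Y - M₂ / k| ≤ |M₁ / k| * (Δ₂ / k + ε') :=
          mul_le_mul_of_nonneg_left hYβ (abs_nonneg _)
        linarith [hXYβ, h2, h3]
    _ = Δ₁₂ / k + 6 * r.N * (Δ₁ / k) + |M₁ / k| * (Δ₂ / k) + ε' * (1 + 6 * (r.N : ℝ) + |M₁ / k|) := by ring
    _ = Δ₁₂ / k + 6 * r.N * (Δ₁ / k) + |M₁ / k| * (Δ₂ / k) + ε := by rw [hε'D]

end Orbit

/-! ## §4 The prices at the registered typing `1 ≤ depth` -/

section Price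

variable (a : ℝ → ℝ) {ι : Type} [Fintype ι] [Nonempty ι]

/-- **δ-robust orbit test: clause 2 prices an APPROXIMATELY one-orbit degenerate box by the orbit covariance of its density field minus the
tolerance**, at any two cube sites (boundary layer included):
`|M₁₂/k − (M₁/k)(M₂/k)| − (Δ₁₂/k + 6N·Δ₁/k + |M₁/k|·Δ₂/k) ≤ C₂ / min(d_x,d_y)⁴ / (1 + ‖y − x‖)⁴`. [folklore] -/
theorem orbitCov_le_of_e2osc_soft (ha0 : Tendsto a atTop (𝓝 0)) {C₂ ℓ : ℝ} (hℓ : 0 < ℓ)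
    (hE2 : ∃ β₂ : ℝ, ∀ β : ℝ, β₂ ≤ β → ∀ (c : Fin 4 → ℤ) (b : ℕ), (b : ℝ) * a β ≤ ℓ →
      ∀ (η η' : LGConfig 4 G) (x y : Fin 4 → ℤ), 1 ≤ depth c b x → 1 ≤ depth c b y →
        |kerCov G r β c b η (dens G r x) (dens G r y) - kerCov G r β c b η' (dens G r x) (dens G r y)| ≤
          C₂ / ((min (depth c b x) (depth c b y) : ℕ) : ℝ) ^ 4 / (1 + ‖siteToE (y - x)‖) ^ 4)
    (c : Fin 4 → ℤ) (b : ℕ) (η : LGConfig 4 G) (γ : ι → LGConfig 4 G → LGConfig 4 G) (hγ : ∀ i, Continuous (γ i))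
    {x y : Fin 4 → ℤ} (hx : 1 ≤ depth c b x) (hy : 1 ≤ depth c b y) {M₁ M₂ M₁₂ Δ₁ Δ₂ Δ₁₂ : ℝ}
    (h₁ : ∀ ζ ∈ cubeMinimisers G r c b η, |∑ i, dens G r x (γ i (glueWith (cubeEdges c b) ζ η)) - M₁| ≤ Δ₁)
    (h₂ : ∀ ζ ∈ cubeMinimisers G r c b η, |∑ i, dens G r y (γ i (glueWith (cubeEdges c b) ζ η)) - M₂| ≤ Δ₂)
    (h₁₂ : ∀ ζ ∈ cubeMinimisers G r c b η,
      |∑ i, dens G r x (γ i (glueWith (cubeEdges c b) ζ η)) * dens G r y (γ i (glueWith (cubeEdges c b) ζ η)) - M₁₂| ≤ Δ₁₂)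
    (s₁ : ∀ (β : ℝ) (i : ι), kerE G r β c b η (dens G r x ∘ γ i) = kerE G r β c b η (dens G r x))
    (s₂ : ∀ (β : ℝ) (i : ι), kerE G r β c b η (dens G r y ∘ γ i) = kerE G r β c b η (dens G r y))
    (s₁₂ : ∀ (β : ℝ) (i : ι), kerE G r β c b η ((fun U => dens G r x U * dens G r y U) ∘ γ i) =
      kerE G r β c b η (fun U => dens G r x U * dens G r y U)) :
    |M₁₂ / Fintype.card ι - M₁ / Fintype.card ι * (M₂ / Fintype.card ι)| -
        (Δ₁₂ / Fintype.card ι + 6 * r.N * (Δ₁ / Fintype.card ι) + |M₁ / Fintype.card ι| * (Δ₂ / Fintype.card ι)) ≤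
      C₂ / ((min (depth c b x) (depth c b y) : ℕ) : ℝ) ^ 4 / (1 + ‖siteToE (y - x)‖) ^ 4 := by
  obtain ⟨β₂, H2⟩ := hE2
  -- for every `e > 0`: `|K| − E ≤ B + e`, by passing to one large `β`
  refine le_of_forall_pos_le_add fun e he => ?_
  have he2 : 0 < e / 2 := half_pos he
  have h0 : ∀ᶠ β : ℝ in atTop, |kerCov G r β c b 1 (dens G r x) (dens G r y)| ≤ e / 2 := by
    have h := (tendsto_kerCov_one_dens_all r c b x y).abs
    rw [abs_zero] at h
    exact (h.eventually (eventually_le_nhds he2)).mono fun _ h => h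
  have hsoft := eventually_abs_kerCov_sub_orbitCov_le r c b η γ hγ h₁ h₂ h₁₂ s₁ s₂ s₁₂ he2
  obtain ⟨β, hβ0, hβs, hb, hβ2⟩ := (h0.and (hsoft.and ((eventually_mul_le_of_tendsto_zero ha0 hℓ b).and
    (eventually_ge_atTop β₂)))).exists
  have hosc := H2 β hβ2 c b hb η 1 x y hx hy
  set K : ℝ := M₁₂ / Fintype.card ι - M₁ / Fintype.card ι * (M₂ / Fintype.card ι) with hK
  have t1 := (abs_sub_abs_le_abs_sub K (kerCov G r β c b η (dens G r x) (dens G r y))).trans_eq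
    (abs_sub_comm K (kerCov G r β c b η (dens G r x) (dens G r y)))
  have t2 := abs_sub_abs_le_abs_sub (kerCov G r β c b η (dens G r x) (dens G r y)) (kerCov G r β c b 1 (dens G r x) (dens G r y))
  linarith

/-- **δ-robust orbit test, diagonal**: the approximate orbit VARIANCE of the density at any cube site is priced by `C₂/d⁴`:
`M₁₁/k − (M₁/k)² − (Δ₁₁/k + 6N·Δ₁/k + |M₁/k|·Δ₁/k) ≤ C₂/d_x⁴`. [folklore] -/
theorem orbitVar_le_of_e2osc_soft (ha0 : Tendsto a atTop (𝓝 0)) {C₂ ℓ : ℝ} (hℓ : 0 < ℓ)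
    (hE2 : ∃ β₂ : ℝ, ∀ β : ℝ, β₂ ≤ β → ∀ (c : Fin 4 → ℤ) (b : ℕ), (b : ℝ) * a β ≤ ℓ →
      ∀ (η η' : LGConfig 4 G) (x y : Fin 4 → ℤ), 1 ≤ depth c b x → 1 ≤ depth c b y →
        |kerCov G r β c b η (dens G r x) (dens G r y) - kerCov G r β c b η' (dens G r x) (dens G r y)| ≤
          C₂ / ((min (depth c b x) (depth c b y) : ℕ) : ℝ) ^ 4 / (1 + ‖siteToE (y - x)‖) ^ 4)
    (c : Fin 4 → ℤ) (b : ℕ) (η : LGConfig 4 G) (γ : ι → LGConfig 4 G → LGConfig 4 G) (hγ : ∀ i, Continuous (γ i))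
    {x : Fin 4 → ℤ} (hx : 1 ≤ depth c b x) {M₁ M₁₁ Δ₁ Δ₁₁ : ℝ}
    (h₁ : ∀ ζ ∈ cubeMinimisers G r c b η, |∑ i, dens G r x (γ i (glueWith (cubeEdges c b) ζ η)) - M₁| ≤ Δ₁)
    (h₁₁ : ∀ ζ ∈ cubeMinimisers G r c b η,
      |∑ i, dens G r x (γ i (glueWith (cubeEdges c b) ζ η)) * dens G r x (γ i (glueWith (cubeEdges c b) ζ η)) - M₁₁| ≤ Δ₁₁)
    (s₁ : ∀ (β : ℝ) (i : ι), kerE G r β c b η (dens G r x ∘ γ i) = kerE G r β c b η (dens G r x))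
    (s₁₁ : ∀ (β : ℝ) (i : ι), kerE G r β c b η ((fun U => dens G r x U * dens G r x U) ∘ γ i) =
      kerE G r β c b η (fun U => dens G r x U * dens G r x U)) :
    M₁₁ / Fintype.card ι - (M₁ / Fintype.card ι) ^ 2 -
        (Δ₁₁ / Fintype.card ι + 6 * r.N * (Δ₁ / Fintype.card ι) + |M₁ / Fintype.card ι| * (Δ₁ / Fintype.card ι)) ≤
      C₂ / (depth c b x : ℝ) ^ 4 := by
  have h := orbitCov_le_of_e2osc_soft r a ha0 hℓ hE2 c b η γ hγ hx hx h₁ h₁ h₁₁ s₁ s₁ s₁₁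
  have h0 : ‖siteToE (x - x)‖ = 0 := by
    rw [sub_self, show siteToE (0 : Site 4) = 0 from by ext j; simp [siteToE_apply], norm_zero]
  rw [min_self, h0, add_zero, one_pow, div_one] at h
  rw [sq]
  linarith [le_abs_self (M₁₁ / Fintype.card ι - M₁ / Fintype.card ι * (M₁ / Fintype.card ι))]

/-- **δ-robust orbit test, clause 1**: the approximate orbit-MEAN deficit of the density at any cube site is priced by `C₁/d⁴`:
`6N − M₁/k − Δ₁/k ≤ C₁/d_x⁴`. [folklore] -/
theorem orbitMean_deficit_le_of_e1osc_soft (ha0 : Tendsto a atTop (𝓝 0)) {C₁ ℓ : ℝ} (hℓ : 0 < ℓ)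
    (hE1 : ∃ β₁ : ℝ, ∀ β : ℝ, β₁ ≤ β → ∀ (c : Fin 4 → ℤ) (b : ℕ), (b : ℝ) * a β ≤ ℓ →
      ∀ (η η' : LGConfig 4 G) (x : Fin 4 → ℤ), 1 ≤ depth c b x →
        |kerE G r β c b η (dens G r x) - kerE G r β c b η' (dens G r x)| ≤ C₁ / (depth c b x : ℝ) ^ 4)
    (c : Fin 4 → ℤ) (b : ℕ) (η : LGConfig 4 G) (γ : ι → LGConfig 4 G → LGConfig 4 G) (hγ : ∀ i, Continuous (γ i))
    {x : Fin 4 → ℤ} (hx : 1 ≤ depth c b x) {M₁ Δ₁ : ℝ}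
    (h₁ : ∀ ζ ∈ cubeMinimisers G r c b η, |∑ i, dens G r x (γ i (glueWith (cubeEdges c b) ζ η)) - M₁| ≤ Δ₁)
    (s₁ : ∀ (β : ℝ) (i : ι), kerE G r β c b η (dens G r x ∘ γ i) = kerE G r β c b η (dens G r x)) :
    6 * (r.N : ℝ) - M₁ / Fintype.card ι - Δ₁ / Fintype.card ι ≤ C₁ / (depth c b x : ℝ) ^ 4 := by
  obtain ⟨β₁, H1⟩ := hE1
  refine le_of_forall_pos_le_add fun e he => ?_
  have he2 : 0 < e / 2 := half_pos he
  have h0 : ∀ᶠ β : ℝ in atTop, |kerE G r β c b 1 (dens G r x) - 6 * (r.N : ℝ)| ≤ e / 2 := by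
    have h := tendsto_kerE_one_dens_all r c b x
    rw [Metric.tendsto_atTop] at h
    obtain ⟨β₀, hβ₀⟩ := h (e / 2) he2
    exact Filter.eventually_atTop.2 ⟨β₀, fun β hβ => by rw [← Real.dist_eq]; exact (hβ₀ β hβ).le⟩
  have hsoft := eventually_abs_kerE_sub_orbitMean_le r c b η γ (fun i => (continuous_dens r x).comp (hγ i)) h₁ s₁ he2
  obtain ⟨β, hβ0, hβs, hb, hβ1⟩ := (h0.and (hsoft.and ((eventually_mul_le_of_tendsto_zero ha0 hℓ b).and
    (eventually_ge_atTop β₁)))).exists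
  have hosc := H1 β hβ1 c b hb 1 η x hx
  rw [abs_le] at hβ0 hβs hosc
  linarith [hβ0.1, hβ0.2, hβs.1, hβs.2, hosc.1, hosc.2]

end Price

/-! ## §5 The kill-path feed: approximate orbit families with non-decaying robust covariance -/

section LRO

variable {ι : Type} [Fintype ι] [Nonempty ι]

/-- **δ-robust orbit family ⇒ unbounded zero-temperature floor.**  Suppose that for every `n` there are a cube, an exterior `η`, a finite non-empty
family `γ` of continuous maps leaving the cube kernel of `η` invariant (on continuous observables), two cube sites `x, y` (depth `≥ 1`) at separation
`≥ n`, and numbers `M₁, M₂, M₁₂, Δ₁, Δ₂, Δ₁₂` bounding the orbit sums of `dens_x`, `dens_y`, `dens_x·dens_y` on the ground states to within the `Δ`'s,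
whose ROBUST orbit covariance is at least `c₀ > 0`: `c₀ + (Δ₁₂/k + 6N·Δ₁/k + |M₁/k|·Δ₂/k) < |M₁₂/k − (M₁/k)(M₂/k)|`.  Then
`ZeroTempCovFloorUnbounded G r` — and so clause 2 fails at `(G, r)` for every unit (`not_e2osc_of_zeroTempCovFloorUnbounded`). [folklore] -/
theorem zeroTempCovFloorUnbounded_of_softOrbit {c₀ : ℝ} (hc₀ : 0 < c₀)
    (h : ∀ n : ℕ, ∃ (c : Fin 4 → ℤ) (b : ℕ) (η : LGConfig 4 G) (γ : ι → LGConfig 4 G → LGConfig 4 G) (x y : Fin 4 → ℤ)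
      (M₁ M₂ M₁₂ Δ₁ Δ₂ Δ₁₂ : ℝ),
      (∀ i, Continuous (γ i)) ∧
      (∀ (β : ℝ) (i : ι) (F : LGConfig 4 G → ℝ), Continuous F → kerE G r β c b η (F ∘ γ i) = kerE G r β c b η F) ∧
      1 ≤ depth c b x ∧ 1 ≤ depth c b y ∧ (n : ℝ) ≤ ‖siteToE (y - x)‖ ∧
      (∀ ζ ∈ cubeMinimisers G r c b η, |∑ i, dens G r x (γ i (glueWith (cubeEdges c b) ζ η)) - M₁| ≤ Δ₁) ∧
      (∀ ζ ∈ cubeMinimisers G r c b η, |∑ i, dens G r y (γ i (glueWith (cubeEdges c b) ζ η)) - M₂| ≤ Δ₂) ∧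
      (∀ ζ ∈ cubeMinimisers G r c b η,
        |∑ i, dens G r x (γ i (glueWith (cubeEdges c b) ζ η)) * dens G r y (γ i (glueWith (cubeEdges c b) ζ η)) - M₁₂| ≤ Δ₁₂) ∧
      c₀ + (Δ₁₂ / Fintype.card ι + 6 * r.N * (Δ₁ / Fintype.card ι) + |M₁ / Fintype.card ι| * (Δ₂ / Fintype.card ι)) <
        |M₁₂ / Fintype.card ι - M₁ / Fintype.card ι * (M₂ / Fintype.card ι)|) :
    ZeroTempCovFloorUnbounded G r := by
  refine zeroTempCovFloorUnbounded_of_nondecaying r hc₀ fun n => ?_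
  obtain ⟨c, b, η, γ, x, y, M₁, M₂, M₁₂, Δ₁, Δ₂, Δ₁₂, hγ, hsymm, hx, hy, hsep, h₁, h₂, h₁₂, hgap⟩ := h n
  refine ⟨c, b, η, x, y, hx, hy, hsep, Filter.Eventually.frequently ?_⟩
  have hε : 0 < |M₁₂ / Fintype.card ι - M₁ / Fintype.card ι * (M₂ / Fintype.card ι)| -
      (Δ₁₂ / Fintype.card ι + 6 * r.N * (Δ₁ / Fintype.card ι) + |M₁ / Fintype.card ι| * (Δ₂ / Fintype.card ι)) - c₀ := by
    linarith
  have hsoft := eventually_abs_kerCov_sub_orbitCov_le r c b η γ hγ h₁ h₂ h₁₂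
    (fun β i => hsymm β i _ (continuous_dens r x)) (fun β i => hsymm β i _ (continuous_dens r y))
    (fun β i => hsymm β i _ ((continuous_dens r x).mul (continuous_dens r y))) hε
  filter_upwards [hsoft] with β hβ
  set K : ℝ := M₁₂ / Fintype.card ι - M₁ / Fintype.card ι * (M₂ / Fintype.card ι) with hK
  have t1 := (abs_sub_abs_le_abs_sub K (kerCov G r β c b η (dens G r x) (dens G r y))).trans_eq
    (abs_sub_comm K (kerCov G r β c b η (dens G r x) (dens G r y)))
  linarith

end LRO

end Summit.QuantumFields.YangMills.Cruxes.NT.ClassicalShadow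

end
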